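import Mathlib
import HarnessLib
import Literature.MathematicalPhysics.QuantumFieldTheory.ConstructiveQFTWave0
import Summits.Ventures.LatticeQCDFlow.Exactness.JarzynskiFinite
import Summits.Ventures.LatticeQCDFlow.Scaling.ImportanceWeights
import Summits.Ventures.LatticeQCDFlow.Scaling.StochasticFlows

/-!
# LatticeQCDFlow / Scaling — the venture's CONJECTURE items (Gβ), (U′), (C2a), typed

HONEST FRAMING: exact (Metropolis-corrected) sampling algorithms for lattice gauge theory;
figures of merit are autocorrelation/cost numbers at stated couplings and volumes; no
continuum-physics claim.

Venture `LatticeQCDFlow` (cell pub-lqcd), topic `Scaling`.  These are OUR conjectures — the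
physics hypotheses under which the PROVED scaling cores (`Scaling/*.lean`, `Scaling/Barriers.lean`)
become statements about the Wilson lattice gauge measure — typed by the theory seat
(HOME/THEORY-2-Sketch.lean v1.5, namespace kept, decls verbatim; THEORY-2.md §7 R-T2-5) and landed
by FANOUT row 31.  They are `@[conjecture]` definitions under the Venture, NEVER Literature facts,
each docstring carrying its cheapest falsifier.  Vocabulary: the tree's
`Literature.MathematicalPhysics.QuantumFieldTheory.{GaugeConfig, Edge, Site, wilsonMeasure,
wilsonExpectation, plaquetteHolonomy, haarProbability}` (torus `(ℤ/L)^d`, compact group `G`,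
matrix representation `ρ`).

* `LaplaceHalfMass` — (Gβ), the Laplace / low-action-volume hypothesis of the COUPLING law
  (`Barriers.ConcentrationBudget`);
* `CrossCutCorrelatorFloor` — (U′), the reduced volume-law hypothesis (one connected cross-cut
  plaquette correlator bounded below uniformly in `L`; T2-N `Theory2.defectFromCorrelation`
  turns it into the block defect (U) of `Barriers.VolumeScalingOfTraining`);
* `ExactTransportBiLipschitz` — (C2a), the bi-Lipschitz obstruction for EXACT transport of the
  Haar prior onto the Wilson law.
Deliberately NOT typed here (reasons in THEORY-2.md §7): C1 (Lüscher's volume-uniform radius —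
theory1's `TrivializingMaps/` item), C2b, C3′ (`PerfectRelaxationDominates`, needs the path-space
file), C4, C5.
-/

namespace Summit.Ventures.LatticeQCDFlow.Conjectures

open MeasureTheory Literature.MathematicalPhysics.QuantumFieldTheory

/-- **(Gβ) Laplace / low-action-volume hypothesis of the coupling law (THEORY-2.md §3.2;
conjecture at printed-law level).**  Uniformly in the volume, at weak coupling the Wilson law puts
half of its mass on a set of product-Haar measure `≤ (c₀/β)^{n_tr(L)/2}`, where `n_tr(L)` is the
number of transverse (non-zero-mode) directions, `(d−1)(N²−1)L^d` for `SU(N)` up to `O(1)` zero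
modes — supplied by the user as the function `nTr`.  With `Barriers.ConcentrationBudget` and
`Theory2.map_apply_le_of_preimage_le` it forces total log-volume-contraction
`≥ (n_tr/2)·log(β/c₀) − O(1)` on any flow from the Haar prior with ESS bounded below.
Cheapest falsifier: one U(1) plaquette (closed form `I₀`; holds), then 2-d U(1) at `L = 4…16`
(exactly solvable sector sums). -/
@[conjecture]
def LaplaceHalfMass (d N : ℕ) (G : Type) [Group G] [TopologicalSpace G] [IsTopologicalGroup G]
    [CompactSpace G] [MeasurableSpace G] [BorelSpace G] (ρ : G →* Matrix (Fin N) (Fin N) ℂ)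
    (nTr : ℕ → ℝ) : Prop :=
  ∃ c₀ : ℝ, 0 < c₀ ∧ ∃ β₀ : ℝ, 0 < β₀ ∧ ∀ (L : ℕ) [NeZero L] (β : ℝ), β₀ ≤ β →
    ∃ E : Set (GaugeConfig d L G), MeasurableSet E ∧
      (2 : ENNReal)⁻¹ ≤ wilsonMeasure (d := d) (L := L) ρ β E ∧
      Measure.pi (fun _ : Edge d L => haarProbability G) E ≤
        ENNReal.ofReal ((c₀ / β) ^ (nTr L / 2))

/-- **(U′) reduced volume-law hypothesis (THEORY-2.md §3.1, v1.3): a connected plaquette–plaquette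
correlator across a cut of width `2R+1` is bounded away from zero uniformly in the volume at fixed
`β`.**  By `Theory2.defectFromCorrelation` (T2-N) this gives hypothesis (U) (a volume-uniform block
defect `δ ≥ |⟨P₁;P₂⟩|/6` of the Wilson law against every across-gap-independent law, in particular
against every range-`R` flow push-forward of a product prior), hence the exponential volume law
for fixed-receptive-field flows (`Barriers.VolumeScalingOfTraining`).  A theorem at strong coupling
(cluster expansion, `|⟨P;P⟩| ≍ (β/2N²)^{4·dist}` > 0 at fixed distance); conjectural at
intermediate β only in its UNIFORMITY in `L`.  Plaquettes in the `(i,j)` plane at `x` and at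
`x + (2R+1)·e_a`.  Cheapest falsifier: 2-d U(1) (exact: plaquettes independent in infinite volume
⇒ the connected correlator is a pure finite-volume effect there and (U′) FAILS in `d = 2` — file
with `d ≥ 3` or with Polyakov-loop-free observables; recorded so the item is not mis-filed). -/
@[conjecture]
def CrossCutCorrelatorFloor (d N : ℕ) (G : Type) [Group G] [TopologicalSpace G]
    [IsTopologicalGroup G] [CompactSpace G] [MeasurableSpace G] [BorelSpace G]
    (ρ : G →* Matrix (Fin N) (Fin N) ℂ) (β : ℝ) (R : ℕ) (i j a : Fin d) : Prop :=
  ∃ δ : ℝ, 0 < δ ∧ ∃ L₀ : ℕ, ∀ (L : ℕ) [NeZero L], L₀ ≤ L → ∀ x : Site d L,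
    δ ≤ |wilsonExpectation (d := d) (L := L) ρ β
            (fun U => (ρ (plaquetteHolonomy U x i j)).trace.re *
              (ρ (plaquetteHolonomy U (x + Pi.single a ((2 * R + 1 : ℕ) : ZMod L)) i j)).trace.re) -
          wilsonExpectation (d := d) (L := L) ρ β
              (fun U => (ρ (plaquetteHolonomy U x i j)).trace.re) *
            wilsonExpectation (d := d) (L := L) ρ β
              (fun U => (ρ (plaquetteHolonomy U (x + Pi.single a ((2 * R + 1 : ℕ) : ZMod L))
                i j)).trace.re)|

/-- **(C2a) exact transport of the Haar prior onto the Wilson law is `e^{cβ}`-bi-Lipschitz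
(THEORY-2.md §3.3, v1.1 restatement of C2; the gen-1 TV-approximate form is FALSE).**  For `G`
with a bi-invariant metric and the sup metric on configurations: any bi-Lipschitz `T` with
`T_*(⊗Haar) = μ_β` has `Lip(T)·Lip(T⁻¹) ≥ e^{cβ}` with `c` independent of `L`.  In substance a
consequence of the density ratio `e^{β(S_max − S_min)}` and the Jacobian bound for Lipschitz maps
(so "conjecture as filed, theorem modulo Mathlib's change of variables on compact groups"); the
open content is C2b (ε-accurate flows), untyped.  Cheapest falsifier: one U(1) link, `T` the
inverse-CDF map of the von Mises law (explicit Lipschitz constants `≍ e^{β}`/`I₀`-ratios). -/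
@[conjecture]
def ExactTransportBiLipschitz (d N : ℕ) (G : Type) [Group G] [MetricSpace G]
    [IsTopologicalGroup G] [CompactSpace G] [MeasurableSpace G] [BorelSpace G]
    (ρ : G →* Matrix (Fin N) (Fin N) ℂ) : Prop :=
  ∃ c : ℝ, 0 < c ∧ ∃ β₀ : ℝ, ∀ (L : ℕ) [NeZero L] (β : ℝ), β₀ ≤ β →
    ∀ (T : GaugeConfig d L G → GaugeConfig d L G) (K K' : NNReal),
      LipschitzWith K T → AntilipschitzWith K' T →
      (Measure.pi fun _ : Edge d L => haarProbability G).map T =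
          wilsonMeasure (d := d) (L := L) ρ β →
      Real.exp (c * β) ≤ (K : ℝ) * K'

/-! ### Appended: (C3′) — the fourth conjecture item (needs `Scaling/StochasticFlows.lean`) -/

/-- **(C3′) perfect relaxation dominates — monotone protocols, positive layers (THEORY-2.md §3.5,
v1.5.1; replaces conjecture C3, which is FALSE for echo layers: a reflection protocol on `ℤ_m` has
`W ≡ ΔF`, `ÊSS = 1`).**  For a one-parameter exponential-family protocol `S_k = β_k · A` with
`β_0 ≤ β_1 ≤ … ≤ β_n` and MC layers `P_k` that are row-stochastic, in detailed balance with
`e^{−S_{k+1}}` AND positive semidefinite as self-adjoint operators on `ℓ²(p_{k+1})`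
(`Σ_{x,y} e^{−S_{k+1}(x)} P_k(x,y) f(x) f(y) ≥ 0`: heat bath, lazy Metropolis — NOT over-relaxation
or reflections), the NE-MCMC / SNF effective sample size is at most its PERFECT-RELAXATION value
`Π_k ESS(p_{k+1}, p_k)` (T2-W, `Theory2.ess_perfect_relaxation`, is the equality case; the
identity layers give the other extreme `ESS(p_n, p_0)`).  Finite-state statement over row 30's
`Exactness.pathLaw` / `gibbsLaw` and row 31's `Theory2.revPathLaw` / `essFrac`; no literature
import.  EVIDENCE (theory2 gen-4, exact path enumeration, local < 10 s): 3- and 4-state chains,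
`n ≤ 3`, random `A`, lazy heat-bath and lazy-Metropolis layers: 0 / 8500 violations; BOTH
hypotheses are necessary — 2200 / 3000 violations without monotonicity (worst ratio 184),
148 / 3000 without positivity (full Metropolis, worst ratio 1.0195).  Cheapest falsifier beyond
that: 5–6 states, `n = 4`, two-humped `A` with near-degenerate intermediate laws; a proof attempt
would go through the spectral (Dirichlet-form) representation of `⟨e^{−2W_d}⟩` layer by layer. -/
@[conjecture]
def PerfectRelaxationDominates : Prop :=
  ∀ (X : Type) [Fintype X] [DecidableEq X] [Nonempty X] (n : ℕ) (A : X → ℝ) (β : Fin (n+1) → ℝ)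
    (P : Fin n → X → X → ℝ),
    Monotone β →
    (∀ k, Literature.Probability.MarkovChains.IsRowStochastic (P k)) →
    (∀ k : Fin n, Literature.Probability.MarkovChains.DetailedBalance
        (fun x => Real.exp (-(β k.succ * A x))) (P k)) →
    (∀ (k : Fin n) (f : X → ℝ),
        0 ≤ ∑ x, ∑ y, Real.exp (-(β k.succ * A x)) * P k x y * f x * f y) →
    Theory2.essFrac (Theory2.revPathLaw (fun k x => β k * A x) P)
        (Exactness.pathLaw (Exactness.gibbsLaw (fun x => β 0 * A x)) P) ≤
      ∏ k : Fin n, Theory2.essFrac (Exactness.gibbsLaw (fun x => β k.succ * A x))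
        (Exactness.gibbsLaw (fun x => β k.castSucc * A x))

/-! ### Appended: (U″) — the fifth conjecture item, the clustering floor behind `Barriers.ReceptiveFieldLaw` (T2-Z, `Scaling/ReceptiveField.lean`) -/

/-- **(U″) clustering floor (THEORY-2.md §3.1, v1.6): the connected plaquette–plaquette correlator
of the Wilson law decays NO FASTER than exponentially, uniformly in the volume.**  At fixed `β`
there are `κ₀ > 0`, `ξ > 0` with
`|⟨P(x) P(x + s e_a)⟩ − ⟨P(x)⟩⟨P(x + s e_a)⟩| ≥ κ₀ e^{−s/ξ}` for all `L ≥ L₀`, all separations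
`4s ≤ L` and all sites (plaquettes in the `(i, j)` plane, normalised `P = Re tr ρ(holonomy)`,
`|P| ≤ N`).  Implies `CrossCutCorrelatorFloor` for every `R` (take
`s = 2R + 1`), and through T2-N (`κ = κ₀/(6N²)`) + T2-Z (`Barriers.ReceptiveFieldLaw`) the
logarithmic receptive-field law.  A THEOREM at strong coupling (convergent cluster expansion: the
leading connected diagram is a tube of plaquettes, `≍ (β/2N²)^{4s}`, lower-order cancellations
absent by positivity of the character expansion) [cite: OsterwalderSeiler1978]; conjectural at
intermediate β only in its uniformity in `L`; FALSE in `d = 2` (plaquettes independent) — file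
with `d ≥ 3`.  Cheapest falsifier: 3-d Z₂ / U(1) at β well inside the strong-coupling disc,
`L = 8, 12, 16`, separations `s ≤ 4` (character-expansion numbers vs. Monte Carlo). -/
@[conjecture]
def ClusteringFloor (d N : ℕ) (G : Type) [Group G] [TopologicalSpace G]
    [IsTopologicalGroup G] [CompactSpace G] [MeasurableSpace G] [BorelSpace G]
    (ρ : G →* Matrix (Fin N) (Fin N) ℂ) (β : ℝ) (i j a : Fin d) : Prop :=
  ∃ κ₀ : ℝ, 0 < κ₀ ∧ ∃ ξ : ℝ, 0 < ξ ∧ ∃ L₀ : ℕ, ∀ (L : ℕ) [NeZero L], L₀ ≤ L →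
    ∀ s : ℕ, 4 * s ≤ L → ∀ x : Site d L,
      κ₀ * Real.exp (-((s : ℝ) / ξ)) ≤
        |wilsonExpectation (d := d) (L := L) ρ β
            (fun U => (ρ (plaquetteHolonomy U x i j)).trace.re *
              (ρ (plaquetteHolonomy U (x + Pi.single a ((s : ℕ) : ZMod L)) i j)).trace.re) -
          wilsonExpectation (d := d) (L := L) ρ β
              (fun U => (ρ (plaquetteHolonomy U x i j)).trace.re) *
            wilsonExpectation (d := d) (L := L) ρ β
              (fun U => (ρ (plaquetteHolonomy U (x + Pi.single a ((s : ℕ) : ZMod L))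
                i j)).trace.re)|

end Summit.Ventures.LatticeQCDFlow.Conjectures
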